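import Summits.BirchSwinnertonDyer.BirchSwinnertonDyer.Theorems.ThetaPartnerAtTwoSignedKatoUpToAtTwoOfPubLayerSide
import Summits.BirchSwinnertonDyer.BirchSwinnertonDyer.Theorems.ThetaPartnerAtTwoSignedKatoUpToAtTwoLayerKummerWitness
import Summits.BirchSwinnertonDyer.BirchSwinnertonDyer.Theorems.ThetaPartnerAtTwoSignedKatoUpToAtTwoLayerPairingPk
import Summits.BirchSwinnertonDyer.BirchSwinnertonDyer.Theorems.ThetaPartnerAtTwoSignedKatoUpToAtTwoLayerPairingCompat
import Summits.BirchSwinnertonDyer.BirchSwinnertonDyer.Theorems.ThetaPartnerAtTwoSignedKatoUpToAtTwoLayerPTOrthFinal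
import Summits.BirchSwinnertonDyer.BirchSwinnertonDyer.Theorems.ThetaPartnerAtTwoSignedKatoUpToAtTwoLayerSideNoPTOfCore
import Summits.BirchSwinnertonDyer.BirchSwinnertonDyer.Theorems.ThetaPartnerAtTwoSignedKatoUpToAtTwoCoreOfLayerErl
import Summits.BirchSwinnertonDyer.BirchSwinnertonDyer.Theorems.ThetaPartnerAtTwoSignedKatoUpToAtTwoCorePairCertificates
import Summits.BirchSwinnertonDyer.BirchSwinnertonDyer.Theorems.ThetaPartnerAtTwoSignedKatoUpToAtTwoKatoBKSocketKZ
import Summits.BirchSwinnertonDyer.BirchSwinnertonDyer.Theorems.ThetaPartnerAtTwoSignedKatoUpToAtTwoKatoBKCoreKZLit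
import Literature.NumberTheory.EllipticCurves.Kato2004.EulerSystemTatePairingValuesTwo
import Summits.BirchSwinnertonDyer.BirchSwinnertonDyer.Theorems.ThetaPartnerAtTwoSignedKatoUpToAtTwoKatoBKBricks
import Summits.BirchSwinnertonDyer.BirchSwinnertonDyer.Theorems.ThetaPartnerAtTwoSignedKatoUpToAtTwoKatoBKCuspBrick
import Literature.NumberTheory.EllipticCurves.RohrlichNonvanishingRankinProofs
import Summits.BirchSwinnertonDyer.BirchSwinnertonDyer.Theses.ThetaPartnerAtTwo
import Summits.BirchSwinnertonDyer.BirchSwinnertonDyer.Theses.ResidualThetaTransportAtTwo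
import HarnessLib

/-!
# K3P′ `SignedKatoDivisibilityUpToAtTwoOfPub` (stmt-BirchSwinnertonDyer-25631) — skeleton line `colemanrat` v12-P (lead prover bsd-wall-tp2-p2x g6, 2026-08-28; v11-P sha16 38a415e33df5954c; v10-P sha16 ad050af77c95d52a; v8-P lead g5; v7-P sha16 0bdde8f0a8317578)

Route `route-BirchSwinnertonDyer-ThetaPartnerAtTwo` (TP2) crux K3P′ rank 4 (= support r9 on `route-BirchSwinnertonDyer-ResidualThetaTransportAtTwo`):
the PUB-bound twin of K3 `SignedKatoDivisibilityUpToAtTwo` (item 20308, line `colemanrat` v7, sha16 4099f1720feba091):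
`Kato2004.thm13_4_two_lengthAt_fineSelmerDualContra_le_of_isEulerSystemClassTwo → rank_eq_analyticRank_of_analyticRank_le_one → ⟨K3 body⟩`.
Its two antecedents are EXACTLY the two PUB-shaped stubs of `colemanrat` v7 (`stub_katoBoundTwoInv` up to w3's `katoBoundTwoInv_of_contra`,
and `stub_gzkTwo`), so on K3P′ the line has exactly the NON-PUB-binder stubs of `colemanrat` v8 on 20308, VERBATIM (same names + signatures — one `--supports`
proof serves both items): `stub_ptOrthLayerTwo` (S2, kernel: Poitou–Tate at a finite layer/level over the (D-layer) pairings) and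
`stub_layerSideNoPTTwo` (S3′: (D-layer) theorem + Honda + PUB (ES)/(ERL♭)); the v7 residue (R2c) `stub_layerSideTwoInv` is DERIVED (glue). Composition = the landed certificate
`SignedKatoOffTwo.signedKatoDivisibilityUpToAtTwo_of_contraFact_of_gzk_of_layerSide` (p603443, `Theorems/…OfPubLayerSide.lean`).
What (R2c) is and how it files: `Cruxes/SignedKatoDivisibilityUpToAtTwo/G4-LEAD-v7.md` §2 ((D-layer) definition «T₂E-adic local Tate pairing
at layer n with (P1)(P2)(P3)» + Poitou–Tate assembly along `ℚ_∞` + the PUB pair Kato Thm. 12.5 / explicit reciprocity at 2). K3P′ is NOT settled;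
BSD is not proved by any of this.
-/

/-! WHAT CHANGED v8-P → v9-P (lead g5, 2026-08-28 08:4xZ; twin of `Lines/colemanrat.lean` v9). (S2) `stub_ptOrthLayerTwo` is LANDED
(`SignedKatoOffTwo.LayerPTFinal.stub_ptOrthLayerTwo`, p615870) and cited by name; (S3′) `stub_layerSideNoPTTwo` is a THEOREM from the
PUB-only stub `stub_katoZetaErlTwo` (S3″: Kato's `2`-adic zeta element + explicit reciprocity law at `2` for THE `T₂E`-adic local Tate
pairing of the layers) + w3's (D-layer) theorem `LayerPairing.exists_linear_layerPairing` (p613655) + (WEIL) `weilTowerPk_step`. ONE stub: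
{`stub_katoZetaErlTwo`} (PUB). K3P′ is NOT settled; BSD is not proved by any of this. -/

/-! WHAT CHANGED v9-P → v10-P (lead g5, 2026-08-28 08:4xZ). The PUB stub `stub_katoZetaErlTwo` (S3″) is now LITERALLY the hypothesis CORE (`hcore`) of
w3's landed certificate `SignedKatoOffTwo.NoPTOfCore.layerSideNoPTTwo_of_core` (`Theorems/…LayerSideNoPTOfCore.lean`, p615686): the same statement
as v9's S3″ except that the pinned `𝐇¹`-datum `I` is UNIVERSAL (`IwasawaH1Data` is pinned — `proj_injective`/`proj_surjective` — and
`IsEulerSystemClassTwo I s` depends only on the projections, so every `I` carries Kato's class; the tree has `Kato2004.nonempty_iwasawaH1Data_holds`).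
(S3′) := `NoPTOfCore.layerSideNoPTTwo_of_core stub_katoZetaErlTwo` (by name); the inline (WEIL) lemma of v9 is dropped (tree:
`LayerPairing.weilTowerPk_two_succ_of_coe_eq`). One PUB statement for lead, width seats, pen and typer. BSD is not proved by any of this. -/

/-! WHAT CHANGED v10-P → v11-P (lead g6, 2026-08-28 09:5xZ). The (R4) COLEMAN-MAP ALGEBRA of CORE's (ERL♭) clause is now KERNEL, twice: the width
seat w2 g5 landed `Theorems/…ColemanMazurTateGlue.lean` (p619726, `SignedKatoOffTwo.CoreFin.*`) + `Theorems/…CoreOfFiniteErl.lean`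
(`CoreFin.core_of_coreFin : CORE_fin → CORE`, `core_of_coreCol`), and the lead landed `Theorems/…MazurTateValuesCore.lean` (p619938,
`SignedKatoOffTwo.MTValues.*`, `core_of_mtvCore : MTV-CORE → CORE`, the `r ∈ ℚˣ` variant) — both by «Mazur–Tate values + Pollack/Sprung pair ⇒
integral chromatic limit ⇒ `Sprung2017.IsChromaticLimit.unique` (2 ∣ a₂) ⇒ lengths at 𝔭 ∌ 2». So v10's PUB stub CORE `stub_katoZetaErlTwo` is a
THEOREM (`:= CoreFin.core_of_coreFin stub_katoFiniteErlTwo`) from the NEW, strictly print-closer PUB stub `stub_katoFiniteErlTwo` (S3‴ = CORE_fin,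
the weakest of the landed sockets): CORE with (ERL♭) «every Coleman pair `(L♯', L♭')` of `col₀ s` has `ℓ_𝔭(Λ/(L♭')) ≤ ℓ_𝔭(Λ/(L♭))`» REPLACED by the
finite-level MAZUR–TATE VALUE congruences (ERL_fin) «`ν·P_{n,d_n}(col₀ s) ≡ μ·θ_n(f) (mod ω_n)` in `Λ ⊗ ℚ₂`, `μ, ν ∉ 𝔭`» = the printed sentence
«`P_{n,c_n}(z_Kato) = θ_n`» (Kobayashi (8.23)–(8.26) + Kato 12.5; Kurihara 2002; Sprung 2012 Prop. 6.3–6.5; Otsuki 2009 Thm. 3.6/4.1 at `p = 2`).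
Also since v10: THE pairing has Literature names (w3 g5: `CyclotomicLayer.tatePairingPk`, p619606; bridges `…LayerPairingLiterature`, p620560).
ONE stub: {`stub_katoFiniteErlTwo`} (PUB); composition unchanged.
BSD is not proved by any of this. -/

/-! WHAT CHANGED v11-P → v12-P (lead g6, 2026-08-28 09:5xZ). The width seat w2 g5 landed `Theorems/…CoreOfLayerErl.lean` (p621423):
`CoreFin.pairingSum_tower_eq_layer` (the pairing sum of a tower functional is that of its layer restriction) and `CoreFin.core_of_corePair :
CORE_pair → CORE`, with CORE_pair = CORE whose (ERL♭) is replaced by the finite-level law ON THE LAYER PAIRING «`ν·P_{n,d_n}(pair n (I.proj n s))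
≡ μ·θ_n (mod ω_n)`» — no tower glue `col₀`, no `localTowerPointsOfEmb`; this is WEAKER than v11's CORE_fin and is symbol for symbol Kobayashi's
(8.23) / Sprung's Def. 3.1 on `H¹(ℚ_n, T₂E) × E(ℚ_{n,v})`. So v12 registers `stub_katoLayerErlTwo` (S3⁗ = CORE_pair = `hpair` VERBATIM) and CORE
`stub_katoZetaErlTwo` := `CoreFin.core_of_corePair stub_katoLayerErlTwo`; v11's `stub_katoFiniteErlTwo` is dropped (it is implied by CORE_pair via
`pairingSum_tower_eq_layer`, and was only a socket). Also landed since v11: the lead's `Literature/…/CongrModOmegaOfValuesProofs.lean` (p622184: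
«values at ζ−1 ⇒ congruence mod ω_n», the bridge from Kato's / Kobayashi's CHARACTER-VALUE statements to (ERL_pair)); w3 g6 builds the
character-value socket CORE_χ on it. ONE stub {`stub_katoLayerErlTwo`} (PUB); composition unchanged. BSD is not proved by any of this. -/

/-! WHAT CHANGED v12-P → v13-P (lead g7, 2026-08-28). As on 20308's skeleton v13: the PUB stub CORE_pair is derived in the kernel from the print-closer
PUB stub `stub_katoValuesBKTwo` = CORE_KBK (the tree fact `Kato2004.exists_eulerSystem_expStar_values` in shape + ONE Bloch–Kato clause (C6) on THE
layer pairing) through the LEAD's socket `KatoBK.corePairChiPrim_of_coreKBK_of_bricks` and w3's `CoreChi.core_of_corePairChi ∘ corePairChi_of_corePairChiPrim`,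
with the kernel bricks B4a/B4b/B4c cited by name (`KatoBK.*_brick`) and B1 `stub_cuspGenerationTwo` (cusp-element generation mod 𝔭, w2 g6 / w5 g0
landed theorems; DISCHARGED by name: `KatoBK.cuspBrick_of_rohrlich Rohrlich1984_nonvanishing_twists_holds`). Stubs {`stub_katoValuesBKTwo` (PUB)} — the ONE displayed hypothesis of K3P′ after v13 is CORE_KBK. BSD is not proved by any of this. -/

/-! WHAT CHANGED v13 → v14 (lead g7, 2026-08-28 13:3xZ). (1) Pre-registration hygiene RESHAPE of v13 (width w5 g2 `W5G2-IOTA-PIN.md`, second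
reader w4 g3): CORE_KBK's complex embeddings are PINNED (`ι_{2^k}(ζ_{2^k}) = e^{2πi/2^k}`) — CORE_KBK_std, socket `KatoBK.corePairChiPrim_of_coreKBKStd_of_bricks`
(lead, p635470); v13 was registered in that shape (sha16 78a4808e7c3251d0 / f07629578d271654). (2) v14 displays the strictly WEAKER PUB stub
**`stub_katoValuesKZTwo` = CORE_KZ** (width w3 g8): Kato's (C1)–(C5) at the standard embeddings with ONE `(κ, Λ)` as before, but the Bloch–Kato
input asserted ONLY AT THE DISPLAYED ZETA CLASSES and Λ-free — «the layer Tate pairing of `Cor z_{2^{n+2}}` with formal layer-`n` points is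
`Σ_b τ_b•(log_ω Q̃ · e_{n+2}(x_{n+2}))`» (Kato Thm. 12.5 (1) through BK (3.10.1)/(3.11.1) = Kobayashi (8.25)'s input); `KatoBK.coreKZ_of_coreKBKStd :
CORE_KBK_std → CORE_KZ` (w3 g8, p636379) and the socket `KatoBK.corePairChiPrim_of_coreKZ_of_bricks` (w3 g8, p636266, re-cut of p635470). No
`exp*`-as-a-map residue remains in the displayed hypothesis. Stubs {`stub_katoValuesKZTwo` (PUB)} — the ONE displayed hypothesis of K3P′;
kernel bricks B1/B4a/B4b/B4c cited by name as in v13; composition unchanged. BSD is not proved by any of this. -/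

/-! WHAT CHANGED v14.1 → v15 (lead g8, 2026-08-28 14:4xZ). The displayed PUB stub is RE-KEYED INTO LITERATURE VOCABULARY:
**`stub_katoValuesKZLitTwo` = CORE_KZ_Lit** — the same mathematics as CORE_KZ (Kato's (C1)–(C5) `ZetaBody` at the standard complex embeddings ∧ the
layer Tate pairing law at the displayed zeta classes) with every Summits-side name removed: the pairing value is an element `t : ℤ₂` given through its
residues `CyclotomicLayer.tatePairingPk` (w3 g5's Literature port of THE `T₂W`-adic layer pairings; no auxiliary `pair`, no (P1)/(P2)/(P3)), the
logarithm is `Σᵢ logᵢ(W ⊗ ℚ₂)·z(Q₀)ⁱ` (`WeierstrassCurve.formalLog`, Mathlib `zCoord`, summed in `PadicAlgCl 2`), the formal-group condition is the carrier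
of `FormalGroupChart.kernel`, the `2`-adic frame is ANY COHERENT tower `e_{k+1}(ζ)² = e_k(ζ)` with Galois lifts `τ` (coherence is load-bearing: with
(C1) and the projection formula an incoherent level-wise frame would be refutable), idle binders (`¬CM`, `r_an = 0`, `a₂ = 0`, `γ`, `ϖ`, Pollack, `ι`)
dropped. `stub_katoValuesKZTwo` (CORE_KZ) := `KatoBK.coreKZ_of_coreKZLit stub_katoValuesKZLitTwo` (lead g8, p640162) is now a THEOREM. CORE_KZ_Lit is
the text of the proposed Literature fact `Kato2004.exists_eulerSystem_expStar_tatePairing_values_two` (p640688, review lane; file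
`Literature/NumberTheory/EllipticCurves/Kato2004/EulerSystemTatePairingValuesTwo.lean`) — when it lands, v16 displays the fact BY NAME and K3 ⟸ three
NAMED Literature facts {that fact, Kato 13.4 (2) at `2`, GZK}. Certificates by name: `KatoBK.signedKatoDivisibilityUpToAtTwoOfPub_of_coreKZLit`,
`…_of_contraFact_of_gzk_of_coreKZLit` (`Theorems/…OfPubKZLit.lean`, lead g8). Everything else unchanged. BSD is not proved by any of this. -/

/-! WHAT CHANGED v15 → v16 (lead g8, 2026-08-28 14:5xZ). The Literature fact LANDED (p640688 ✓, commit fac5d23d7a7c):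
`Literature/NumberTheory/EllipticCurves/Kato2004/EulerSystemTatePairingValuesTwo.lean`, `Kato2004.exists_eulerSystem_expStar_tatePairing_values_two` —
Kato 2004 Thm. 12.5 (1) [with (8.1.3)/Ex. 13.3, 8.12, 9.7, 6.6 (1) as `ZetaBody`] read on the layer Tate pairing (Rubin 1998 §5 (2) / Thm. 7.1, Kobayashi
2003 (8.23)/(8.29)/Prop. 8.25, Bloch–Kato 1990 §3). The displayed PUB stub is now that fact BY NAME: **`stub_katoTatePairingFactTwo`**; `stub_katoValuesKZLitTwo`
(CORE_KZ_Lit, its text verbatim) := the fact, `stub_katoValuesKZTwo` (CORE_KZ) := `KatoBK.coreKZ_of_coreKZLit …` — both THEOREMS. Registered stubs (20308):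
{`stub_katoTatePairingFactTwo`, `stub_katoBoundTwoContra`, `stub_gzkTwo`} = THREE NAMED LITERATURE FACTS VERBATIM (`def … : Prop`, none proved in the tree);
(25631): {`stub_katoTatePairingFactTwo`} ALONE. Certificates by name: `KatoBK.signedKatoDivisibilityUpToAtTwoOfPub_of_kato_tatePairing_fact : fact → K3P′`,
`KatoBK.signedKatoDivisibilityUpToAtTwo_of_kato_facts_of_gzk : 13.4(2)@2 → GZK → fact → K3` (+ `_rtt_`) in `Theorems/…OfPubKatoFact.lean` (lead g8, p642700,
--workitem 25631: conditional-result posture). NOTHING kernel-side is open on this line; the items close the day the facts' `_holds` land. BSD is not proved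
by any of this. -/

set_option autoImplicit false
set_option linter.dupNamespace false

noncomputable section

open scoped Classical MatrixGroups ModularForm NumberField

open CongruenceSubgroup WeierstrassCurve Field IsDedekindDomain NumberField
  Literature.NumberTheory.GaloisRepresentations
  Literature.NumberTheory.EllipticCurves Literature.NumberTheory.EllipticCurves.ModularForms
  Literature.NumberTheory.EllipticCurves.Module Literature.NumberTheory.EllipticCurves.Rank1Residual
  Literature.NumberTheory.EllipticCurves.Kobayashi2003 Literature.NumberTheory.EllipticCurves.Kato2004
  Literature.NumberTheory.EllipticCurves.Kato2004.EulerSystemValues Literature.NumberTheory.EllipticCurves.GreenbergSelmer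
  Literature.NumberTheory.EllipticCurves.Sprung2012
  ZpExtension Summit.BirchSwinnertonDyer.Rank1Residual.Supersingular
  Summit.BirchSwinnertonDyer.BirchSwinnertonDyer.Theorems.SignedKatoOffTwo
  Literature.NumberTheory.EllipticCurves.FormalGroupChart
  Summit.BirchSwinnertonDyer.Rank1Residual.Additive Summit.BirchSwinnertonDyer.Rank1Residual.Additive.PadicCyclotomicTower
  Summit.BirchSwinnertonDyer.Rank1Residual.Additive.BallEval
  Summit.BirchSwinnertonDyer.BirchSwinnertonDyer.Theorems.SignedKatoOffTwo.LocalTwo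

open scoped TensorProduct

namespace Summit.BirchSwinnertonDyer.BirchSwinnertonDyer.Cruxes.SignedKatoDivisibilityUpToAtTwoOfPub.ColemanRat

/-- (S2 = PT-orth AT A FINITE LAYER AND LEVEL; v9-P: THEOREM = `SignedKatoOffTwo.LayerPTFinal.stub_ptOrthLayerTwo`, p615870; KERNEL/ASSEMBLY — the lead's S2 architecture: global Shapiro over `Γ_ℚ` +
Tate reciprocity over `ℚ` + SH-VANISH at `v ∤ 2∞` + one orbit at `v ∣ 2` + real places `2`-torsion; landed pieces: `LayerPT.two_nsmul_…`
(T2, p611917), `LayerShapiro…AwayVanishing`, `ContinuousShapiroLiftVanishing/RestrictHom`, `BrauerSumTwoTorsionAtOnePlace`, w2's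
`WeilPairingShapiroLevelTransport`, w3's `LayerGlobalShapiro`). For EVERY bilinear Galois-equivariant `μ`-valued family `e_k` on `E[2^k]`
compatible in `k` (`e_{k+1}(S', T') = e_k(S, T)` when `S = 2S'`, `T' = T`), every layer `N`, level `L₀`, class `x ∈ H¹(Γ_N, T₂E)`, every
CLASSICAL layer Selmer class `t ∈ Sel_{2^∞}(E/ℚ_N)` with a cocycle `φ_N` killed by `2^{L₀}` whose restriction to `U_N = Gal(ℚ̄_v/ℚ_N·ℚ_v)` is the
Kummer cocycle of a point `Q'` with `2^{L₀}Q' ∈ E(ℚ_N·ℚ_v)`: the layer pairing value is `2`-TORSION,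
`2 • ⟨red_{2^{L₀}} x, 2^{L₀}Q'⟩_{N,2^{L₀}} = 0` (`layerPairingPk`, (D-layer)). Habitat-free (any `W/ℚ`); `m = 1` is forced by the real places.
[cite: Kobayashi2003, (7.16)–(7.21) (p. 12)] [cite: Kato2004Asterisque, §17.13 (p. 279)] [cite: MilneADT2006, Ch. I, Thm. 4.10(b), Ex. 1.6 (c)] -/
theorem stub_ptOrthLayerTwo :
    ∀ (v : HeightOneSpectrum (𝓞 ℚ)), ((2 : ℕ) : 𝓞 ℚ) ∈ v.asIdeal →
    ∀ (W : WeierstrassCurve ℚ) [W.IsElliptic] [ContinuousSMul ℤ_[2] (W.tateModule 2)]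
      (κ : ZpExtension ℚ 2), κ.IsCyclotomic →
    ∀ (ePk : ∀ k : ℕ, geomTorsion W (2 ^ k) → geomTorsion W (2 ^ k) → AlgebraicClosure ℚ)
      (hμ : ∀ k S T, ePk k S T ^ (2 ^ k) = 1)
      (hadd₁ : ∀ k S₁ S₂ T, ePk k (S₁ + S₂) T = ePk k S₁ T * ePk k S₂ T)
      (hadd₂ : ∀ k S T₁ T₂, ePk k S (T₁ + T₂) = ePk k S T₁ * ePk k S T₂)
      (hgal : ∀ k (σ : absoluteGaloisGroup ℚ) (S T : geomTorsion W (2 ^ k)), σ • ePk k S T = ePk k (σ • S) (σ • T)),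
      (∀ (k : ℕ) (S' : geomTorsion W (2 ^ (k + 1))) (S : geomTorsion W (2 ^ k)) (T' : geomTorsion W (2 ^ (k + 1)))
          (T : geomTorsion W (2 ^ k)), (S : W.geomPoints) = (2 : ℤ) • (S' : W.geomPoints) →
          (T' : W.geomPoints) = (T : W.geomPoints) → ePk (k + 1) S' T' = ePk k S T) →
    ∀ (N L₀ : ℕ) (x : H1 (tateRep W 2) (κ.layerSubgroup N))
      (t : W.subgroupH1 2 (κ.layerSubgroup N)), t ∈ W.selmerLayer κ N →
    ∀ (φN : contOneCocycles (discreteTopRep (κ.layerSubgroup N) (W.geomPrimaryTorsion 2))), oneCocycleClass _ φN = t →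
      (∀ y, (2 ^ L₀ : ℕ) • ((φN.1 y : W.geomPrimaryTorsion 2) : W.geomPoints) = 0) →
    ∀ (Q' : localPoints W (v.adicCompletion ℚ))
      (hP' : (2 ^ L₀ : ℕ) • Q' ∈ localLayerPointsOfEmb κ (closureEmb (K := ℚ) (v.adicCompletion ℚ)) W N),
      (∀ τ : localSubgroupOfEmb (κ.layerSubgroup N) (closureEmb (K := ℚ) (v.adicCompletion ℚ)),
        pointsMapOfEmb W (closureEmb (K := ℚ) (v.adicCompletion ℚ))
            ((φN.1 (resGalSubgroupOfEmb (κ.layerSubgroup N) _ τ) : W.geomPrimaryTorsion 2) : W.geomPoints) =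
          (τ : absoluteGaloisGroup (v.adicCompletion ℚ)) • Q' - Q') →
      2 • LayerPairing.layerPairingPk W κ v ePk hμ hadd₁ hadd₂ hgal N L₀ x ⟨(2 ^ L₀ : ℕ) • Q', hP'⟩ = 0 :=
  -- v9-P: LANDED (p615870) — cited by name, registered signature verbatim
  LayerPTFinal.stub_ptOrthLayerTwo

set_option backward.isDefEq.respectTransparency false in
/-- stub (PUB = THE NAMED LITERATURE FACT, v16 — lead g8): **`Kato2004.exists_eulerSystem_expStar_tatePairing_values_two`** VERBATIM
(`Literature/NumberTheory/EllipticCurves/Kato2004/EulerSystemTatePairingValuesTwo.lean`, p640688; `def … : Prop`, no `_holds`): Kato's `2`-adic zeta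
elements of `T₂W` with their dual-exponential values (`ZetaBody`) and the layer Tate pairing law `⟨Cor z_{2^{n+2}}, Q⟩_n = Tr(log_ω Q · x_{2^{n+2}})` for
formal points of the cyclotomic layers — Kato Thm. 12.5 (1) read through Rubin 1998 §5 (2) / Kobayashi 2003 (8.29) / Bloch–Kato §3. THE published
input of K3/K3P′; closes the day its `_holds` lands.
[cite: Kato2004Asterisque, Thm. 12.5 (1) (pp. 221–222), (8.1.3) (p. 180), Prop. 8.12 (p. 186), Thm. 9.7 (p. 189), Thm. 6.6 (1) (p. 163), Ex. 13.3 (p. 225)]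
[cite: Rubin1998Durham, §5 displays (1)–(2), Thm. 7.1] [cite: Kobayashi2003, Thm. 5.2 (i) (p. 9), (8.23) (p. 18), (8.29) and Prop. 8.25 (p. 24)]
[cite: BlochKato1990, Prop. 3.8 (p. 354), Def. 3.10, Ex. 3.10.1 (pp. 359–360), Ex. 3.11 (p. 361)] -/
theorem stub_katoTatePairingFactTwo : Kato2004.exists_eulerSystem_expStar_tatePairing_values_two := by
  sorry

set_option backward.isDefEq.respectTransparency false in
/-- (CORE_KZ_Lit, THEOREM since v16 := the named fact `stub_katoTatePairingFactTwo` unfolded; was the registered PUB stub of v15 — lead g8): **Kato's zeta values at the standard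
complex embeddings + the layer Tate pairing law at the displayed zeta classes, in Literature + Mathlib names only.** For the place `v ∋ 2`,
`W` globally minimal with good supersingular reduction at `2`, the cyclotomic `κ`, the newform `f`, every continuous frame `Φ : ℚ̄₂ ≅ \overline{ℚ_v}`
over `φ : ℚ₂ ≅ ℚ_v`, every COHERENT tower of `2`-adic embeddings `e_k : ℚ(ζ_{2^k}) → ℚ̄₂` (`e_{k+1}(ζ)² = e_k(ζ)`) with Galois lifts `τ`, and the
STANDARD complex embeddings: ONE `κ ≠ 0` and ONE datum `Λ` such that for all admissible `(c, d, a, A)` there are `z`, `x` with `ZetaBody` (C1)–(C5)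
[Kato 2004 (8.1.3)/Ex. 13.3, Prop. 8.12, Lemma 8.5, Thm. 9.7, Thm. 6.6 (1)] AND (KZ) for every formal layer-`n` point `Q₀` the `T₂W`-adic layer
Tate pairing value `t = ⟨Cor z_{2^{n+2}}, Q₀⟩_n ∈ ℤ₂`, given through its residues `CyclotomicLayer.tatePairingPk W κ v n k`, equals
`Σ_{b∈(ℤ/2^{n+2})ˣ} τ_b (log_{W⊗ℚ₂}(z(Q₀)) · e_{n+2}(x_{n+2}))` (`log_{W⊗ℚ₂}` = `WeierstrassCurve.formalLog` of `W ⊗ ℚ₂` summed at Mathlib's `zCoord`)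
[Kato Thm. 12.5 (1) read on the pairing: Rubin 1998 §5 (2) / Thm. 7.1, Kobayashi 2003 (8.29) / Prop. 8.25, Bloch–Kato (3.10.1)/(3.11.1)].
No Summits-side name occurs in the statement (no `pair`/(P1)/(P2)/(P3), no `ptLogΩ`/`toLoc`/`genFibΩ`/`baseChange_twoAdicModel`, no chosen
tower `zeta`); it is the text of the Literature fact `Kato2004.exists_eulerSystem_expStar_tatePairing_values_two` (proposed p640688, review lane) and
the hypothesis of the tree theorem `KatoBK.coreKZ_of_coreKZLit` (p640162) VERBATIM. EVERYTHING between this stub and K3P′ is KERNEL.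
[cite: Kato2004Asterisque, (5.7.1) (p. 157), (8.1.3) (p. 180), Ex. 13.3 (p. 225), Thm. 9.7 (p. 189), Thm. 6.6 (1) (p. 163), Thm. 12.5 (1) (pp. 221–222)]
[cite: Rubin1998Durham, §5 displays (1)–(2), Thm. 7.1] [cite: Kobayashi2003, (8.23), (8.29), Prop. 8.25] [cite: BlochKato1990, Def. 3.10, Ex. 3.10.1, (3.11.1), Prop. 3.8] -/
theorem stub_katoValuesKZLitTwo :
    ∀ (v : HeightOneSpectrum (𝓞 ℚ)), ((2 : ℕ) : 𝓞 ℚ) ∈ v.asIdeal →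
    ∀ (W : WeierstrassCurve ℚ) [W.IsElliptic] [W.IsGloballyMinimal], GoodSS W 2 →
      ∀ (κ : ZpExtension ℚ 2) (hκ : κ.IsCyclotomic),
        ∀ [NeZero (W.conductorNorm ℤ)] (f : CuspForm (Gamma0 (W.conductorNorm ℤ)) 2), IsNewformOf W f →
        ∀ [ContinuousSMul ℤ_[2] (W.tateModule 2)] [Module.Free ℤ_[2] (W.tateModule 2)]
          [Module.Finite ℤ_[2] (W.tateModule 2)],
        ∀ (Φ : AlgebraicClosure ℚ_[2] ≃ₐ[ℚ] AlgebraicClosure (v.adicCompletion ℚ)) (φ : ℚ_[2] ≃+* v.adicCompletion ℚ),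
          (∀ y : ℚ_[2], Φ (algebraMap ℚ_[2] (AlgebraicClosure ℚ_[2]) y) =
            algebraMap (v.adicCompletion ℚ) (AlgebraicClosure (v.adicCompletion ℚ)) (φ y)) →
        ∀ (e : ∀ k : ℕ, CyclotomicField (cycLevel 2 k ∅) ℚ →ₐ[ℚ] PadicAlgCl 2)
          (τ : ∀ m : ℕ, ZMod (2 ^ m) → Field.absoluteGaloisGroup ℚ_[2]),
          -- the `2`-adic frame: a COHERENT tower `e_{k+1}(ζ_{2^{k+1}})² = e_k(ζ_{2^k})` with Galois lifts `τ_a : e_k(ζ) ↦ e_k(ζ)^a`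
          (∀ k : ℕ, e (k + 1) (IsCyclotomicExtension.zeta (cycLevel 2 (k + 1) ∅) ℚ (CyclotomicField (cycLevel 2 (k + 1) ∅) ℚ)) ^ 2 =
            e k (IsCyclotomicExtension.zeta (cycLevel 2 k ∅) ℚ (CyclotomicField (cycLevel 2 k ∅) ℚ))) →
          (∀ (k : ℕ) (a : ZMod (2 ^ k)), IsUnit a →
            τ k a • e k (IsCyclotomicExtension.zeta (cycLevel 2 k ∅) ℚ (CyclotomicField (cycLevel 2 k ∅) ℚ)) =
              e k (IsCyclotomicExtension.zeta (cycLevel 2 k ∅) ℚ (CyclotomicField (cycLevel 2 k ∅) ℚ)) ^ a.val) →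
        -- the complex frame: the STANDARD embeddings at the pure levels (Kato (5.7.1))
        ∀ (ιC : (m : ℕ) → (CyclotomicField m ℚ →+* ℂ)),
        (∀ k : ℕ, ιC (cycLevel 2 k ∅) (IsCyclotomicExtension.zeta (cycLevel 2 k ∅) ℚ (CyclotomicField (cycLevel 2 k ∅) ℚ)) =
          Complex.exp (2 * Real.pi * Complex.I / (cycLevel 2 k ∅ : ℕ))) →
        ∃ κK : ℝ, κK ≠ 0 ∧
        ∃ ΛK : ∀ (k : ℕ) (r : Finset (HeightOneSpectrum (𝓞 ℚ))),
            H1 (tateRep W 2) (cycSubgroup 2 k r) →ₗ[ℤ_[2]] ℚ_[2] ⊗[ℚ] CyclotomicField (cycLevel 2 k r) ℚ,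
          ∀ (c d a : ℤ) (A : ℕ), 0 < A → Int.gcd c (6 * 2 * A) = 1 → Int.gcd d (6 * 2 * W.conductorNorm ℤ) = 1 →
            ∃ (z : ∀ (k : ℕ) (r : (cyclotomicLevelsRat 2 (badPlaces c d A (W.conductorNorm ℤ))).Ideals),
                  H1 (tateRep W 2) ((cyclotomicLevelsRat 2 (badPlaces c d A (W.conductorNorm ℤ))).level k r.1))
              (x : ∀ (k : ℕ) (r : (cyclotomicLevelsRat 2 (badPlaces c d A (W.conductorNorm ℤ))).Ideals),
                  CyclotomicField (cycLevel 2 k r.1) ℚ),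
              ZetaBody W 2 f ιC κK ΛK c d a A z x ∧
              ∀ (n : ℕ) (Q₀ : localPoints W ℚ_[2])
                (hQv : WeierstrassCurve.Affine.Point.map (W' := W)
                    (Φ : AlgebraicClosure ℚ_[2] →ₐ[ℚ] AlgebraicClosure (v.adicCompletion ℚ))
                    (show (W.baseChange (AlgebraicClosure ℚ_[2])).toAffine.Point from Q₀) ∈
                  localLayerPointsOfEmb κ (closureEmb (K := ℚ) (v.adicCompletion ℚ)) W n),
                (∀ (X Y : AlgebraicClosure ℚ_[2]) (hXY : (W.baseChange (AlgebraicClosure ℚ_[2])).toAffine.Nonsingular X Y),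
                    (show (W.baseChange (AlgebraicClosure ℚ_[2])).toAffine.Point from Q₀) = .some X Y hXY → 1 < Valued.v X) →
                ∃ t : ℤ_[2],
                  (∀ k : ℕ, CyclotomicLayer.tatePairingPk W κ v n k
                      (levelToLayerTwo W hκ (∅ : Set (HeightOneSpectrum (𝓞 ℚ))) n
                        (z (n + 2) (cyclotomicLevelsRat 2 (badPlaces c d A (W.conductorNorm ℤ))).idealOne))
                      ⟨_, hQv⟩ = PadicInt.toZModPow k t) ∧
                  algebraMap ℚ_[2] (PadicAlgCl 2) (t : ℚ_[2]) =
                    ∑ b : (ZMod (2 ^ (n + 2)))ˣ, τ (n + 2) (b : ZMod (2 ^ (n + 2))) •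
                      ((∑' i : ℕ, algebraMap ℚ_[2] (PadicAlgCl 2) (PowerSeries.coeff i (W.map (algebraMap ℚ ℚ_[2])).formalLog) *
                          (WeierstrassCurve.Affine.Point.zCoord
                            (show (W.baseChange (AlgebraicClosure ℚ_[2])).toAffine.Point from Q₀)) ^ i) *
                        e (n + 2) (x (n + 2) (cyclotomicLevelsRat 2 (badPlaces c d A (W.conductorNorm ℤ))).idealOne)) :=
  stub_katoTatePairingFactTwo

set_option backward.isDefEq.respectTransparency false in
/-- (CORE_KZ, THEOREM since v15 = `KatoBK.coreKZ_of_coreKZLit stub_katoValuesKZLitTwo`; was the registered PUB stub of v14/v14.1): Kato's zeta values at the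
standard complex embeddings + the Λ-free Bloch–Kato clause at the displayed zeta classes, in the ROUTE's vocabulary (layer pairing `pair` with (P1)(P2)(P3),
`ptLogΩ` on the `2`-adic model, tower `zeta 2`); text = hypothesis `hKZ` of `KatoBK.corePairChiPrim_of_coreKZ_of_bricks` (w3 g8, p636266) VERBATIM.
[cite: Kato2004Asterisque, Thm. 12.5 (1) (pp. 221–222), Ex. 13.3 (p. 225)] [cite: BlochKato1990, Def. 3.10, Ex. 3.10.1, (3.11.1)] [cite: Kobayashi2003, (8.22)–(8.25)] -/
theorem stub_katoValuesKZTwo :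
    ∀ (v : HeightOneSpectrum (𝓞 ℚ)), ((2 : ℕ) : 𝓞 ℚ) ∈ v.asIdeal →
    ∀ (W : WeierstrassCurve ℚ) [W.IsElliptic] [W.IsGloballyMinimal],
      ¬ W.HasCM → W.analyticRank = 0 → GoodSS W 2 → W.frobeniusTrace 2 = 0 →
      ∀ (κ : ZpExtension ℚ 2) (γ : Field.absoluteGaloisGroup ℚ) (hκ : κ.IsCyclotomic),
        κ.IsTopGenerator γ → IsCyclotomicVariable 2 γ →
        ∀ [NeZero (W.conductorNorm ℤ)] (f : CuspForm (Gamma0 (W.conductorNorm ℤ)) 2),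
          IsNewformOf W f → ∀ (ϖ : ℚ), (ϖ : ℝ) * W.realPeriodRat = plusPeriod f →
        ∀ (Lplus Lminus : IwasawaAlgebra 2), IsPollackPair f 2 Lplus Lminus →
        ∀ [ContinuousSMul ℤ_[2] (W.tateModule 2)] [Module.Free ℤ_[2] (W.tateModule 2)]
          [Module.Finite ℤ_[2] (W.tateModule 2)],
        ∀ (pair : ∀ n : ℕ, H1 (tateRep W 2) (κ.layerSubgroup n) →ₗ[ℤ_[2]]
            (localLayerPointsOfEmb κ (closureEmb (K := ℚ) (v.adicCompletion ℚ)) W n →+ ℤ_[2])),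
          (∀ (n : ℕ) (x : H1 (tateRep W 2) (κ.layerSubgroup (n + 1))) (Q : localPoints W (v.adicCompletion ℚ))
            (hQ : Q ∈ localLayerPointsOfEmb κ (closureEmb (K := ℚ) (v.adicCompletion ℚ)) W n),
            pair n (layerCores (tateRep W 2) κ n x) ⟨Q, hQ⟩ =
              pair (n + 1) x ⟨Q, localLayerPointsOfEmb_mono κ (closureEmb (K := ℚ) (v.adicCompletion ℚ)) W (Nat.le_succ n) hQ⟩) →
          (∀ (n : ℕ) (g : absoluteGaloisGroup (v.adicCompletion ℚ)) (y : H1 (tateRep W 2) (κ.layerSubgroup n))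
            (Q : localPoints W (v.adicCompletion ℚ))
            (hQ : Q ∈ localLayerPointsOfEmb κ (closureEmb (K := ℚ) (v.adicCompletion ℚ)) W n),
            pair n (conjMap (tateRep W 2).toTopRep (κ.layerSubgroup n) (resGalOfEmb (closureEmb (K := ℚ) (v.adicCompletion ℚ)) g) 1 y)
              ⟨g • Q, smul_mem_localLayerPointsOfEmb κ (closureEmb (K := ℚ) (v.adicCompletion ℚ)) W n g hQ⟩ = pair n y ⟨Q, hQ⟩) →
          (∀ (n k : ℕ) (x : H1 (tateRep W 2) (κ.layerSubgroup n))
            (Q : localLayerPointsOfEmb κ (closureEmb (K := ℚ) (v.adicCompletion ℚ)) W n),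
            PadicInt.toZModPow k (pair n x Q) =
              LayerPairing.layerPairingPk W κ v (LayerPairing.weilTowerPk W) (LayerPairing.weilTowerPk_pow W)
                (LayerPairing.weilTowerPk_add_left W) (LayerPairing.weilTowerPk_add_right W) (LayerPairing.weilTowerPk_smul W)
                n k x Q) →
        ∀ (Φ : AlgebraicClosure ℚ_[2] ≃ₐ[ℚ] AlgebraicClosure (v.adicCompletion ℚ)) (φ : ℚ_[2] ≃+* v.adicCompletion ℚ),
          (∀ y : ℚ_[2], Φ (algebraMap ℚ_[2] (AlgebraicClosure ℚ_[2]) y) =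
            algebraMap (v.adicCompletion ℚ) (AlgebraicClosure (v.adicCompletion ℚ)) (φ y)) →
        ∀ (ι : AlgebraicClosure ℚ →ₐ[ℚ] AlgebraicClosure ℚ_[2]),
          (∀ z, closureEmb (K := ℚ) (v.adicCompletion ℚ) z = Φ (ι z)) →
        ∀ (e : ∀ k : ℕ, CyclotomicField (cycLevel 2 k ∅) ℚ →ₐ[ℚ] PadicAlgCl 2),
          (∀ k, e k (IsCyclotomicExtension.zeta (cycLevel 2 k ∅) ℚ (CyclotomicField (cycLevel 2 k ∅) ℚ)) = zeta 2 k) →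
        ∀ (τ : ∀ m : ℕ, ZMod (2 ^ m) → Field.absoluteGaloisGroup ℚ_[2]),
          (∀ (m : ℕ) (a : ZMod (2 ^ m)), IsUnit a → τ m a • zeta 2 m = zeta 2 m ^ a.val) →
        ∀ (ιC : (m : ℕ) → (CyclotomicField m ℚ →+* ℂ)),
        (∀ k : ℕ, ιC (cycLevel 2 k ∅) (IsCyclotomicExtension.zeta (cycLevel 2 k ∅) ℚ (CyclotomicField (cycLevel 2 k ∅) ℚ)) =
          Complex.exp (2 * Real.pi * Complex.I / (cycLevel 2 k ∅ : ℕ))) →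
        ∃ κK : ℝ, κK ≠ 0 ∧
        ∃ ΛK : ∀ (k : ℕ) (r : Finset (HeightOneSpectrum (𝓞 ℚ))),
            H1 (tateRep W 2) (cycSubgroup 2 k r) →ₗ[ℤ_[2]] ℚ_[2] ⊗[ℚ] CyclotomicField (cycLevel 2 k r) ℚ,
          ∀ (c d a : ℤ) (A : ℕ), 0 < A → Int.gcd c (6 * 2 * A) = 1 → Int.gcd d (6 * 2 * W.conductorNorm ℤ) = 1 →
            ∃ (z : ∀ (k : ℕ) (r : (cyclotomicLevelsRat 2 (badPlaces c d A (W.conductorNorm ℤ))).Ideals),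
                  H1 (tateRep W 2) ((cyclotomicLevelsRat 2 (badPlaces c d A (W.conductorNorm ℤ))).level k r.1))
              (x : ∀ (k : ℕ) (r : (cyclotomicLevelsRat 2 (badPlaces c d A (W.conductorNorm ℤ))).Ideals),
                  CyclotomicField (cycLevel 2 k r.1) ℚ),
              ZetaBody W 2 f ιC κK ΛK c d a A z x ∧
              (haveI := isIntegral_genFib_baseChange 2 ((integralModelInt W).map (Int.castRingHom ℤ_[2]))
               ∀ (n : ℕ) (Q₀ : localPoints W ℚ_[2])
                (hQv : WeierstrassCurve.Affine.Point.map (W' := W)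
                    (Φ : AlgebraicClosure ℚ_[2] →ₐ[ℚ] AlgebraicClosure (v.adicCompletion ℚ))
                    (show (W.baseChange (AlgebraicClosure ℚ_[2])).toAffine.Point from Q₀) ∈
                  localLayerPointsOfEmb κ (closureEmb (K := ℚ) (v.adicCompletion ℚ)) W n),
                (toLoc ((genFibΩ_eq_baseChange ((integralModelInt W).map (Int.castRingHom ℤ_[2]))).trans
                  (baseChange_twoAdicModel W))).symm Q₀ ∈
                  kernel (Valued.v (R := PadicAlgCl 2)) (genFibΩ 2 ((integralModelInt W).map (Int.castRingHom ℤ_[2]))) →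
                algebraMap ℚ_[2] (PadicAlgCl 2)
                    ((pair n (levelToLayerTwo W hκ (∅ : Set (HeightOneSpectrum (𝓞 ℚ))) n
                        (z (n + 2) (cyclotomicLevelsRat 2 (badPlaces c d A (W.conductorNorm ℤ))).idealOne))
                      ⟨_, hQv⟩ : ℤ_[2]) : ℚ_[2]) =
                  ∑ b : (ZMod (2 ^ (n + 2)))ˣ, τ (n + 2) (b : ZMod (2 ^ (n + 2))) •
                    (ptLogΩ 2 ((integralModelInt W).map (Int.castRingHom ℤ_[2]))
                        ((toLoc ((genFibΩ_eq_baseChange ((integralModelInt W).map (Int.castRingHom ℤ_[2]))).trans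
                          (baseChange_twoAdicModel W))).symm Q₀) *
                      e (n + 2) (x (n + 2) (cyclotomicLevelsRat 2 (badPlaces c d A (W.conductorNorm ℤ))).idealOne))) :=
  KatoBK.coreKZ_of_coreKZLit stub_katoValuesKZLitTwo

/-- stub (KERNEL brick B1 = cusp-element GENERATION mod `𝔭`, lead's consumption shape; supplied by w2 g6's
`CuspEval.exists_cuspElement_not_mem_of_rohrlich` (conditional on `Rohrlich1984_nonvanishing_twists` = Kato Thm. 13.5 (2))
/ w5 g0's `MultAvoid.exists_fourTerm_not_mem`; DISCHARGED v13 by w3 g7's adapter `KatoBK.cuspBrick_of_rohrlich` + the tree theorem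
`Rohrlich1984_nonvanishing_twists_holds` — UNCONDITIONAL): for every height-one `𝔭 ∌ 2` an admissible `(c, d, a, 2^e, d′)`, `D ≠ 0`
and `μ̃ ∈ Λ ∖ 𝔭` whose value at every even `2`-power-order `χ` mod `2^{n+2}` is `D·(c²d²[a/A]⁻ − cd²χ(c)[ac/A]⁻ − c²dχ(d)[ad′/A]⁻ + cdχ(c)χ(d)[acd′/A]⁻)`
(Kato §13.12 at `2` over `ℤ₂⟦T⟧`). [cite: Kato2004Asterisque, Lemma 13.10–13.11 (pp. 230–231), §13.12 (pp. 231–233), Thm. 13.5 (2)] -/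
theorem stub_cuspGenerationTwo :
    ∀ {N : ℕ} [NeZero N] (f : CuspForm (Gamma0 N) 2), IsNewform0 f → coeffField f = ⊥ → ¬ 2 ∣ N →
    ∀ 𝔭 : PrimeSpectrum (IwasawaAlgebra 2), 𝔭.asIdeal.height = 1 → PowerSeries.C (2 : ℤ_[2]) ∉ 𝔭.asIdeal →
    ∃ (c d a : ℤ) (ee : ℕ) (d' D : ℤ) (μt : IwasawaAlgebra 2),
      Int.gcd c (6 * 2 * 2 ^ ee) = 1 ∧ Int.gcd d (6 * 2 * N) = 1 ∧ d * d' ≡ 1 [ZMOD ((2 ^ ee : ℕ) : ℤ)] ∧ D ≠ 0 ∧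
      μt ∉ 𝔭.asIdeal ∧
      ∀ (n : ℕ) (χ : DirichletCharacter ℂ_[2] (2 ^ (n + 2))), χ.Even → (∃ j : ℕ, orderOf χ = 2 ^ j) →
        HasSum (fun k ↦ ((algebraMap ℚ_[2] ℂ_[2]).comp (algebraMap ℤ_[2] ℚ_[2])) (PowerSeries.coeff k μt) *
            (χ (5 : ZMod (2 ^ (n + 2))) - 1) ^ k)
          ((D : ℂ_[2]) * ((c : ℂ_[2]) ^ 2 * (d : ℂ_[2]) ^ 2 * ((ratMinusSymbol f ((a : ℚ) / (2 ^ ee : ℕ)) : ℚ) : ℂ_[2])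
            - (c : ℂ_[2]) * (d : ℂ_[2]) ^ 2 * χ (c : ZMod (2 ^ (n + 2))) *
                ((ratMinusSymbol f ((a * c : ℚ) / (2 ^ ee : ℕ)) : ℚ) : ℂ_[2])
            - (c : ℂ_[2]) ^ 2 * (d : ℂ_[2]) * χ (d : ZMod (2 ^ (n + 2))) *
                ((ratMinusSymbol f ((a * d' : ℚ) / (2 ^ ee : ℕ)) : ℚ) : ℂ_[2])
            + (c : ℂ_[2]) * (d : ℂ_[2]) * (χ (c : ZMod (2 ^ (n + 2))) * χ (d : ZMod (2 ^ (n + 2)))) *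
                ((ratMinusSymbol f ((a * c * d' : ℚ) / (2 ^ ee : ℕ)) : ℚ) : ℂ_[2]))) :=
  -- v13: LANDED — width seat w3 g7's adapter `KatoBK.cuspBrick_of_rohrlich` (p633616) of w2 g6's B1 chain, fed with the TREE THEOREM
  -- `Rohrlich1984_nonvanishing_twists_holds` (Rankin–Selberg proof file): B1 is KERNEL and UNCONDITIONAL — cited by name
  KatoBK.cuspBrick_of_rohrlich Literature.NumberTheory.EllipticCurves.Rohrlich1984_nonvanishing_twists_holds

/-- stub (KERNEL brick B4a = Hecke at `2` for the trivial character, lead's shape; supplied by w3 g7's `HeckeBase.ratTwistedSymbolSum_one_level_two_eq_neg`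
/ `…_three_eq_four_mul`, DISCHARGED: `KatoBK.heckeBaseTwo_brick`): `a₂ = 0 ⇒ RTSS f 𝟙₄ = −[0]⁺`, `RTSS f 𝟙₈ = 4[0]⁺`. [cite: MazurTateTeitelbaum1986Invent, §I.4] -/
theorem stub_heckeBaseTwo :
    ∀ {N : ℕ} [NeZero N] (f : CuspForm (Gamma0 N) 2), IsNewform0 f → coeffField f = ⊥ → ¬ 2 ∣ N →
    cuspCoeff f 2 = 0 →
    ratTwistedSymbolSum f (1 : DirichletCharacter ℂ_[2] (2 ^ (0 + 2))) = ((-(ratPlusSymbol f 0) : ℚ) : ℂ_[2]) ∧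
    ratTwistedSymbolSum f (1 : DirichletCharacter ℂ_[2] (2 ^ (1 + 2))) = ((4 * ratPlusSymbol f 0 : ℚ) : ℂ_[2]) :=
  -- v13: LANDED (KatoBK bricks file) — cited by name
  KatoBK.heckeBaseTwo_brick

/-- stub (KERNEL brick B4b = base-case logarithms of the displayed plus Honda points, lead's shape; supplied by w4 g0's
`LocalVar.sum_pow_mul_ptLogΩ_pow_smul_plusHondaPoint_eq_level_zero` / `…_eq_one_level_one`; DISCHARGED: `KatoBK.logBaseTwo_brick`): `Λ(d₀ 0) = −2`,
`Λ(d₀ 1) + g₀•Λ(d₀ 1) = 8`. [cite: Kobayashi2003, §8.4, Prop. 8.26] -/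
theorem stub_logBaseTwo :
    ∀ (W : WeierstrassCurve ℚ) [W.IsElliptic] [W.IsGloballyMinimal]
    {c : ℕ → localPoints W ℚ_[2]} {σ : ℕ → Field.absoluteGaloisGroup ℚ_[2]} {d : ℕ → localPoints W ℚ_[2]},
    (haveI := isIntegral_genFib_baseChange 2 ((integralModelInt W).map (Int.castRingHom ℤ_[2]))
      ∀ m, (toLoc ((genFibΩ_eq_baseChange ((integralModelInt W).map (Int.castRingHom ℤ_[2]))).trans
            (baseChange_twoAdicModel W))).symm (c m) ∈
          subfieldPoints (genFibΩ 2 ((integralModelInt W).map (Int.castRingHom ℤ_[2]))) (layer 2 m).toSubfield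
            coeffs_mem_layer ∧
        (toLoc ((genFibΩ_eq_baseChange ((integralModelInt W).map (Int.castRingHom ℤ_[2]))).trans
            (baseChange_twoAdicModel W))).symm (c m) ∈
          kernel (Valued.v (R := PadicAlgCl 2)) (genFibΩ 2 ((integralModelInt W).map (Int.castRingHom ℤ_[2]))) ∧
        ptLogΩ 2 ((integralModelInt W).map (Int.castRingHom ℤ_[2]))
          ((toLoc ((genFibΩ_eq_baseChange ((integralModelInt W).map (Int.castRingHom ℤ_[2]))).trans
            (baseChange_twoAdicModel W))).symm (c m)) = ell 2 m) →
    (∀ m, 1 ≤ m → σ m • zeta 2 m = (zeta 2 m)⁻¹) →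
    (∀ n, d n = 3 • (c (n + 2) + σ (n + 2) • c (n + 2)) - 2 • c 1) →
    ∀ (n : ℕ), n ≤ 1 → ∀ {g₀ : Field.absoluteGaloisGroup ℚ_[2]}, g₀ • zeta 2 (n + 2) = zeta 2 (n + 2) ^ 5 →
    haveI := isIntegral_genFib_baseChange 2 ((integralModelInt W).map (Int.castRingHom ℤ_[2]))
    ∑ j ∈ Finset.range (2 ^ n), ptLogΩ 2 ((integralModelInt W).map (Int.castRingHom ℤ_[2]))
        ((toLoc ((genFibΩ_eq_baseChange ((integralModelInt W).map (Int.castRingHom ℤ_[2]))).trans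
          (baseChange_twoAdicModel W))).symm (g₀ ^ j • d n)) =
      ((if n = 0 then (-2 : ℚ) else 8 : ℚ) : PadicAlgCl 2) :=
  -- v13: LANDED (KatoBK bricks file) — cited by name
  KatoBK.logBaseTwo_brick

/-- stub (KERNEL brick B4c = Kato's trivial-character values at levels `4, 8`, lead's shape; supplied by w4 g0's `KatoValue.sum_sigma_eq_of_zetaBody`
+ `eulerFactorAtOne_two_eq`; DISCHARGED: `KatoBK.katoTrivialValuesTwo_brick`): `Σ_b σ_b x_{k,∅} = (3/2)·q·[0]⁺·R⁻_𝟙`. [cite: Kato2004Asterisque, Thm. 6.6 (1), Thm. 9.7] -/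
theorem stub_katoTrivialValuesTwo :
    ∀ (W : WeierstrassCurve ℚ) [W.IsElliptic] [W.IsGloballyMinimal], GoodSS W 2 → W.frobeniusTrace 2 = 0 →
    ∀ [NeZero (W.conductorNorm ℤ)] (f : CuspForm (Gamma0 (W.conductorNorm ℤ)) 2), IsNewformOf W f →
    ∀ [ContinuousSMul ℤ_[2] (W.tateModule 2)] [Module.Free ℤ_[2] (W.tateModule 2)] [Module.Finite ℤ_[2] (W.tateModule 2)]
    {ιC : (m : ℕ) → (CyclotomicField m ℚ →+* ℂ)} {κK : ℝ}
    {ΛK : ∀ (k : ℕ) (r : Finset (HeightOneSpectrum (𝓞 ℚ))),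
      H1 (tateRep W 2) (cycSubgroup 2 k r) →ₗ[ℤ_[2]] ℚ_[2] ⊗[ℚ] CyclotomicField (cycLevel 2 k r) ℚ}
    {c d a : ℤ} {A : ℕ}
    {z : ∀ (k : ℕ) (r : (cyclotomicLevelsRat 2 (badPlaces c d A (W.conductorNorm ℤ))).Ideals),
      H1 (tateRep W 2) ((cyclotomicLevelsRat 2 (badPlaces c d A (W.conductorNorm ℤ))).level k r.1)}
    {x : ∀ (k : ℕ) (r : (cyclotomicLevelsRat 2 (badPlaces c d A (W.conductorNorm ℤ))).Ideals),
      CyclotomicField (cycLevel 2 k r.1) ℚ},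
    ZetaBody W 2 f ιC κK ΛK c d a A z x → ∀ {q : ℚ}, κK = q → ∀ {ee : ℕ}, A = 2 ^ ee → ∀ (d' : ℤ), d * d' ≡ 1 [ZMOD (A : ℤ)] →
    ∀ (k : ℕ), 2 ≤ k → k ≤ 3 → Int.gcd (c * d) (cycLevel 2 k (∅ : Finset (HeightOneSpectrum (𝓞 ℚ))) * A) = 1 →
    ∑ b : (ZMod (cycLevel 2 k (∅ : Finset (HeightOneSpectrum (𝓞 ℚ)))))ˣ,
        sigma (cycLevel 2 k (∅ : Finset (HeightOneSpectrum (𝓞 ℚ)))) b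
          (x k (cyclotomicLevelsRat 2 (badPlaces c d A (W.conductorNorm ℤ))).idealOne) =
      ((3 / 2 * q * ratPlusSymbol f 0 *
          (c ^ 2 * d ^ 2 * ratMinusSymbol f ((a : ℚ) / A) - c * d ^ 2 * ratMinusSymbol f ((a * c : ℚ) / A)
            - c ^ 2 * d * ratMinusSymbol f ((a * d' : ℚ) / A) + c * d * ratMinusSymbol f ((a * c * d' : ℚ) / A)) : ℚ) :
        CyclotomicField (cycLevel 2 k (∅ : Finset (HeightOneSpectrum (𝓞 ℚ)))) ℚ) :=
  -- v13: LANDED (KatoBK bricks file) — cited by name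
  KatoBK.katoTrivialValuesTwo_brick

set_option backward.isDefEq.respectTransparency false in
/-- (S3″ = CORE; v12: THEOREM = w2 g5's `CoreFin.core_of_corePair` ((R4) algebra + tower↔layer, kernel) applied to the PUB stub `stub_katoLayerErlTwo` (S3⁗ = CORE_pair); v10 text: the hypothesis `hcore` of w3's landed
`SignedKatoOffTwo.NoPTOfCore.layerSideNoPTTwo_of_core` (p615686) VERBATIM; PUB — Kato's `2`-adic zeta element and the explicit reciprocity
law at `2`): for every pinned `𝐇¹`-datum `I` and every
layer pairing family `pair` with the projection formula (P1), the Galois invariance (P2) and the RESIDUE CLAUSE (P3) for THE Weil pairings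
`LayerPairing.weilTowerPk` — (P3) says `pair n` reduces modulo every `2^k` to THE finite local Tate pairing `inv_v(Sh loc red_k x ∪_{e_{2^k}} Sh κ_k Q)`
of the (D-layer) construction, so `pair` IS the `T₂E`-adic local Tate pairing of the layers `ℚ_{n,v}` and is unique — there are a local
topological generator `g`, a Honda system `d` ((L)(TR)(GEN)(GEN₀), Kobayashi §8 / Kim–Otsuki at `p = 2`), a pinned `𝐇¹`-datum `I` and Kato's
Euler-system class `s ∈ 𝐇¹` (ES: `Kato2004.IsEulerSystemClassTwo`, Kato Thm. 12.5 / §13.8) such that the explicit reciprocity law holds in the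
flat form (ERL♭): for every glue `col₀` of `pair` along `I` and every Coleman pair `(Ls, Lf)` of `col₀ s` (w.r.t. `g`, `d`, layer `0`),
`length_𝔭(Λ/Lf) ≤ length_𝔭(Λ/L_Ko)` at every height-one `𝔭 ∌ 2` (`L_Ko = kobayashiL 1 L⁺ L⁻` for the Pollack pair of the newform; Kato Thm. 16.6 /
§17.13 read through Kobayashi Thm. 6.3). This is a PUBLISHED theorem (Kato 2004 + the `p = 2` signed theory), not kernel work: the tree holds
Kato 12.5 only as the cite-only `Kato2004.exists_eulerSystem_expStar_values`. [cite: Kato2004Asterisque, §12.2 (p. 220), Thm. 12.5 (p. 222), §13.8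
(pp. 228–229), Thm. 16.6, §17.13 (p. 279)] [cite: Kobayashi2003, Thm. 6.3 (p. 11), §8 (8.23) (p. 18)] [cite: PerrinRiou1994Invent, §3.6.1] -/
theorem stub_katoZetaErlTwo :
    ∀ (v : HeightOneSpectrum (𝓞 ℚ)), ((2 : ℕ) : 𝓞 ℚ) ∈ v.asIdeal →
    ∀ (W : WeierstrassCurve ℚ) [W.IsElliptic] [W.IsGloballyMinimal],
      ¬ W.HasCM → W.analyticRank = 0 → GoodSS W 2 → W.frobeniusTrace 2 = 0 →
      ∀ (κ : ZpExtension ℚ 2) (γ : Field.absoluteGaloisGroup ℚ) (hκ : κ.IsCyclotomic),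
        κ.IsTopGenerator γ → IsCyclotomicVariable 2 γ →
        ∀ [NeZero (W.conductorNorm ℤ)] (f : CuspForm (Gamma0 (W.conductorNorm ℤ)) 2),
          IsNewformOf W f → ∀ (ϖ : ℚ), (ϖ : ℝ) * W.realPeriodRat = plusPeriod f →
        ∀ (Lplus Lminus : IwasawaAlgebra 2), IsPollackPair f 2 Lplus Lminus →
        ∀ [ContinuousSMul ℤ_[2] (W.tateModule 2)] [Module.Free ℤ_[2] (W.tateModule 2)]
          [Module.Finite ℤ_[2] (W.tateModule 2)],
        ∀ 𝔭 : PrimeSpectrum (IwasawaAlgebra 2), 𝔭.asIdeal.height = 1 →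
          PowerSeries.C (2 : ℤ_[2]) ∉ 𝔭.asIdeal →
        ∀ (I : Kato2004.IwasawaH1Data W 2 κ γ)
          (pair : ∀ n : ℕ, H1 (tateRep W 2) (κ.layerSubgroup n) →ₗ[ℤ_[2]]
            (localLayerPointsOfEmb κ (closureEmb (K := ℚ) (v.adicCompletion ℚ)) W n →+ ℤ_[2])),
          -- (P1) projection formula
          (∀ (n : ℕ) (x : H1 (tateRep W 2) (κ.layerSubgroup (n + 1))) (Q : localPoints W (v.adicCompletion ℚ))
            (hQ : Q ∈ localLayerPointsOfEmb κ (closureEmb (K := ℚ) (v.adicCompletion ℚ)) W n),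
            pair n (layerCores (tateRep W 2) κ n x) ⟨Q, hQ⟩ =
              pair (n + 1) x ⟨Q, localLayerPointsOfEmb_mono κ (closureEmb (K := ℚ) (v.adicCompletion ℚ)) W (Nat.le_succ n) hQ⟩) →
          -- (P2) Galois invariance, for EVERY `g ∈ Γ_v`
          (∀ (n : ℕ) (g : absoluteGaloisGroup (v.adicCompletion ℚ)) (y : H1 (tateRep W 2) (κ.layerSubgroup n))
            (Q : localPoints W (v.adicCompletion ℚ))
            (hQ : Q ∈ localLayerPointsOfEmb κ (closureEmb (K := ℚ) (v.adicCompletion ℚ)) W n),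
            pair n (conjMap (tateRep W 2).toTopRep (κ.layerSubgroup n) (resGalOfEmb (closureEmb (K := ℚ) (v.adicCompletion ℚ)) g) 1 y)
              ⟨g • Q, smul_mem_localLayerPointsOfEmb κ (closureEmb (K := ℚ) (v.adicCompletion ℚ)) W n g hQ⟩ = pair n y ⟨Q, hQ⟩) →
          -- (P3) `pair` IS the `T₂E`-adic local Tate pairing: residues = the (D-layer) pairings for THE Weil pairings of the tree
          (∀ (n k : ℕ) (x : H1 (tateRep W 2) (κ.layerSubgroup n))
            (Q : localLayerPointsOfEmb κ (closureEmb (K := ℚ) (v.adicCompletion ℚ)) W n),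
            PadicInt.toZModPow k (pair n x Q) =
              LayerPairing.layerPairingPk W κ v (LayerPairing.weilTowerPk W) (LayerPairing.weilTowerPk_pow W)
                (LayerPairing.weilTowerPk_add_left W) (LayerPairing.weilTowerPk_add_right W) (LayerPairing.weilTowerPk_smul W)
                n k x Q) →
        ∃ (g : absoluteGaloisGroup (v.adicCompletion ℚ))
          (_ : κ.IsTopGenerator (resGalOfEmb (closureEmb (K := ℚ) (v.adicCompletion ℚ)) g))
          (d : ℕ → localPoints W (v.adicCompletion ℚ)) (s : I.H),
          (∀ n, d n ∈ localLayerPointsOfEmb κ (closureEmb (K := ℚ) (v.adicCompletion ℚ)) W n) ∧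
          (∀ n, localTraceOfEmb κ (closureEmb (K := ℚ) (v.adicCompletion ℚ)) W (n + 1) (n + 2) (d (n + 2)) = -d n) ∧
          (∀ n : ℕ, 1 ≤ n → ∀ P ∈ localLayerPointsOfEmb κ (closureEmb (K := ℚ) (v.adicCompletion ℚ)) W n,
            ∃ B ∈ AddSubgroup.closure (Set.range fun σ : absoluteGaloisGroup (v.adicCompletion ℚ) ↦ σ • d n),
              ∃ P' ∈ localLayerPointsOfEmb κ (closureEmb (K := ℚ) (v.adicCompletion ℚ)) W (n - 1),
              ∃ R ∈ localLayerPointsOfEmb κ (closureEmb (K := ℚ) (v.adicCompletion ℚ)) W n, P = B + P' + 2 • R) ∧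
          (∀ P ∈ localLayerPointsOfEmb κ (closureEmb (K := ℚ) (v.adicCompletion ℚ)) W 0,
            ∃ a : ℤ, ∃ R ∈ localLayerPointsOfEmb κ (closureEmb (K := ℚ) (v.adicCompletion ℚ)) W 0, P = a • d 0 + 2 • R) ∧
          Kato2004.IsEulerSystemClassTwo W hκ I s ∧
          (∀ col₀ : I.H →+ (localTowerPointsOfEmb κ (closureEmb (K := ℚ) (v.adicCompletion ℚ)) W →+ ℤ_[2]),
            (∀ (n : ℕ) (x : I.H) (Q : localPoints W (v.adicCompletion ℚ)) (hQ : Q ∈ localLayerPointsOfEmb κ (closureEmb (K := ℚ) (v.adicCompletion ℚ)) W n),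
              col₀ x ⟨Q, localLayerPointsOfEmb_le_localTowerPointsOfEmb κ (closureEmb (K := ℚ) (v.adicCompletion ℚ)) W n hQ⟩ = pair n (I.proj n x) ⟨Q, hQ⟩) →
            ∀ Ls Lf : IwasawaAlgebra 2, IsColemanPair κ (closureEmb (K := ℚ) (v.adicCompletion ℚ)) W 0 g d (col₀ s) Ls Lf →
              lengthAt (IwasawaAlgebra 2) (IwasawaAlgebra 2 ⧸ Ideal.span {Lf}) 𝔭 ≤
                lengthAt (IwasawaAlgebra 2) (IwasawaAlgebra 2 ⧸ Ideal.span {kobayashiL 1 Lplus Lminus}) 𝔭) :=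
  -- v13-P: (S3″) ⟸ CORE_pairχ^prim (w3's kernel sockets) ⟸ the LEAD's kernel socket over the PUB stub CORE_KBK and the kernel bricks
  CoreChi.core_of_corePairChi (CoreChi.corePairChi_of_corePairChiPrim
    (KatoBK.corePairChiPrim_of_coreKZ_of_bricks stub_katoValuesKZTwo stub_cuspGenerationTwo stub_heckeBaseTwo stub_logBaseTwo
      stub_katoTrivialValuesTwo))

/-- (S3′ = R2c WITHOUT Poitou–Tate; v10-P: THEOREM = w3's `NoPTOfCore.layerSideNoPTTwo_of_core` (p615686) applied to the PUB stub `stub_katoZetaErlTwo` (S3″ = CORE)): the same data as (R2c) — local lift `g`, plus Honda system `d`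
((L)(TR)(GEN)(GEN₀): tree theorem `SignedEC.PlusLayer.plusHondaSystemTwo_adicCompletion`), the pinned `I`, ℤ₂-linear layer pairings `pair` with
(P1)(P2) — but with (PT-orth) REPLACED by the RESIDUE CLAUSE (P3): `pair` is THE `T₂E`-adic local Tate pairing, i.e. its residues modulo
`2^k` are the finite layer pairings `layerPairingPk` of the (D-layer) construction (`…LayerPairingModDefs/Pk`, cup product of Shapiro lifts with
a compatible bilinear Galois-equivariant family `e_k` on `E[2^k]`) — w3's `exists_linear_layerPairing` — plus the genuine `2`-adic
Euler-system class `s` (ES) and the explicit reciprocity law (ERL♭) for every glue `col₀` of `pair`: Kato's zeta element (Thm. 12.5,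
`Kato2004.exists_eulerSystem_expStar_values`, cite-only in the tree) read through Kobayashi Thm. 6.3 / Sprung §7 at `p = 2` (Otsuki 2009). The
PUB content of K3 is exactly the (ES)+(ERL♭) conjuncts. [cite: Kato2004Asterisque, §12.2 (p. 220), Thm. 12.5 (p. 222), §13.8, §17.13 (p. 279)]
[cite: Kobayashi2003, Thm. 6.3 (p. 11), (8.23) (p. 18), Thm. 7.3] [cite: PerrinRiou1994Invent, §3.6.1] [cite: Sprung2012, Def. 5.9 (p. 1495), §7] -/
theorem stub_layerSideNoPTTwo :
    ∀ (v : HeightOneSpectrum (𝓞 ℚ)), ((2 : ℕ) : 𝓞 ℚ) ∈ v.asIdeal →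
    ∀ (W : WeierstrassCurve ℚ) [W.IsElliptic] [W.IsGloballyMinimal],
      ¬ W.HasCM → W.analyticRank = 0 → GoodSS W 2 → W.frobeniusTrace 2 = 0 →
      ∀ (κ : ZpExtension ℚ 2) (γ : Field.absoluteGaloisGroup ℚ) (hκ : κ.IsCyclotomic),
        κ.IsTopGenerator γ → IsCyclotomicVariable 2 γ →
        ∀ [NeZero (W.conductorNorm ℤ)] (f : CuspForm (Gamma0 (W.conductorNorm ℤ)) 2),
          IsNewformOf W f → ∀ (ϖ : ℚ), (ϖ : ℝ) * W.realPeriodRat = plusPeriod f →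
        ∀ (Lplus Lminus : IwasawaAlgebra 2), IsPollackPair f 2 Lplus Lminus →
        ∀ [ContinuousSMul ℤ_[2] (W.tateModule 2)] [Module.Free ℤ_[2] (W.tateModule 2)]
          [Module.Finite ℤ_[2] (W.tateModule 2)],
        ∀ 𝔭 : PrimeSpectrum (IwasawaAlgebra 2), 𝔭.asIdeal.height = 1 →
          PowerSeries.C (2 : ℤ_[2]) ∉ 𝔭.asIdeal →
        ∃ (g : absoluteGaloisGroup (v.adicCompletion ℚ))
          (_ : κ.IsTopGenerator (resGalOfEmb (closureEmb (K := ℚ) (v.adicCompletion ℚ)) g))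
          (d : ℕ → localPoints W (v.adicCompletion ℚ))
          (I : Kato2004.IwasawaH1Data W 2 κ γ)
          (pair : ∀ n : ℕ, H1 (tateRep W 2) (κ.layerSubgroup n) →ₗ[ℤ_[2]]
            (localLayerPointsOfEmb κ (closureEmb (K := ℚ) (v.adicCompletion ℚ)) W n →+ ℤ_[2]))
          (s : I.H)
          (ePk : ∀ k : ℕ, geomTorsion W (2 ^ k) → geomTorsion W (2 ^ k) → AlgebraicClosure ℚ)
          (hμ : ∀ k S T, ePk k S T ^ (2 ^ k) = 1)
          (hadd₁ : ∀ k S₁ S₂ T, ePk k (S₁ + S₂) T = ePk k S₁ T * ePk k S₂ T)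
          (hadd₂ : ∀ k S T₁ T₂, ePk k S (T₁ + T₂) = ePk k S T₁ * ePk k S T₂)
          (hgal : ∀ k (σ : absoluteGaloisGroup ℚ) (S T : geomTorsion W (2 ^ k)), σ • ePk k S T = ePk k (σ • S) (σ • T)),
          (∀ n, d n ∈ localLayerPointsOfEmb κ (closureEmb (K := ℚ) (v.adicCompletion ℚ)) W n) ∧
          (∀ n, localTraceOfEmb κ (closureEmb (K := ℚ) (v.adicCompletion ℚ)) W (n + 1) (n + 2) (d (n + 2)) = -d n) ∧
          (∀ n : ℕ, 1 ≤ n → ∀ P ∈ localLayerPointsOfEmb κ (closureEmb (K := ℚ) (v.adicCompletion ℚ)) W n,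
            ∃ B ∈ AddSubgroup.closure (Set.range fun σ : absoluteGaloisGroup (v.adicCompletion ℚ) ↦ σ • d n),
              ∃ P' ∈ localLayerPointsOfEmb κ (closureEmb (K := ℚ) (v.adicCompletion ℚ)) W (n - 1),
              ∃ R ∈ localLayerPointsOfEmb κ (closureEmb (K := ℚ) (v.adicCompletion ℚ)) W n, P = B + P' + 2 • R) ∧
          (∀ P ∈ localLayerPointsOfEmb κ (closureEmb (K := ℚ) (v.adicCompletion ℚ)) W 0,
            ∃ a : ℤ, ∃ R ∈ localLayerPointsOfEmb κ (closureEmb (K := ℚ) (v.adicCompletion ℚ)) W 0, P = a • d 0 + 2 • R) ∧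
          (∀ (n : ℕ) (x : H1 (tateRep W 2) (κ.layerSubgroup (n + 1))) (Q : localPoints W (v.adicCompletion ℚ))
            (hQ : Q ∈ localLayerPointsOfEmb κ (closureEmb (K := ℚ) (v.adicCompletion ℚ)) W n),
            pair n (layerCores (tateRep W 2) κ n x) ⟨Q, hQ⟩ =
              pair (n + 1) x ⟨Q, localLayerPointsOfEmb_mono κ (closureEmb (K := ℚ) (v.adicCompletion ℚ)) W (Nat.le_succ n) hQ⟩) ∧
          (∀ (n : ℕ) (y : H1 (tateRep W 2) (κ.layerSubgroup n)) (Q : localPoints W (v.adicCompletion ℚ))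
            (hQ : Q ∈ localLayerPointsOfEmb κ (closureEmb (K := ℚ) (v.adicCompletion ℚ)) W n),
            pair n (conjMap (tateRep W 2).toTopRep (κ.layerSubgroup n) (resGalOfEmb (closureEmb (K := ℚ) (v.adicCompletion ℚ)) g) 1 y)
              ⟨g • Q, smul_mem_localLayerPointsOfEmb κ (closureEmb (K := ℚ) (v.adicCompletion ℚ)) W n g hQ⟩ = pair n y ⟨Q, hQ⟩) ∧
          -- (WEIL) one-step level compatibility of the family `e_k`
          (∀ (k : ℕ) (S' : geomTorsion W (2 ^ (k + 1))) (S : geomTorsion W (2 ^ k)) (T' : geomTorsion W (2 ^ (k + 1)))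
            (T : geomTorsion W (2 ^ k)), (S : W.geomPoints) = (2 : ℤ) • (S' : W.geomPoints) →
            (T' : W.geomPoints) = (T : W.geomPoints) → ePk (k + 1) S' T' = ePk k S T) ∧
          -- (P3) the residue clause: `pair` is THE local Tate pairing of the (D-layer) construction
          (∀ (n k : ℕ) (x : H1 (tateRep W 2) (κ.layerSubgroup n))
            (Q : localLayerPointsOfEmb κ (closureEmb (K := ℚ) (v.adicCompletion ℚ)) W n),
            PadicInt.toZModPow k (pair n x Q) = LayerPairing.layerPairingPk W κ v ePk hμ hadd₁ hadd₂ hgal n k x Q) ∧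
          Kato2004.IsEulerSystemClassTwo W hκ I s ∧
          (∀ col₀ : I.H →+ (localTowerPointsOfEmb κ (closureEmb (K := ℚ) (v.adicCompletion ℚ)) W →+ ℤ_[2]),
            (∀ (n : ℕ) (x : I.H) (Q : localPoints W (v.adicCompletion ℚ)) (hQ : Q ∈ localLayerPointsOfEmb κ (closureEmb (K := ℚ) (v.adicCompletion ℚ)) W n),
              col₀ x ⟨Q, localLayerPointsOfEmb_le_localTowerPointsOfEmb κ (closureEmb (K := ℚ) (v.adicCompletion ℚ)) W n hQ⟩ = pair n (I.proj n x) ⟨Q, hQ⟩) →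
            ∀ Ls Lf : IwasawaAlgebra 2, IsColemanPair κ (closureEmb (K := ℚ) (v.adicCompletion ℚ)) W 0 g d (col₀ s) Ls Lf →
              lengthAt (IwasawaAlgebra 2) (IwasawaAlgebra 2 ⧸ Ideal.span {Lf}) 𝔭 ≤
                lengthAt (IwasawaAlgebra 2) (IwasawaAlgebra 2 ⧸ Ideal.span {kobayashiL 1 Lplus Lminus}) 𝔭) :=
  -- v10: (S3′) ⟸ CORE, w3's landed certificate (p615686), fed with the registered PUB stub
  NoPTOfCore.layerSideNoPTTwo_of_core stub_katoZetaErlTwo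

/-! ### Glue (v8, KERNEL): (R2c) ⟸ S2 ∧ S3′ — the registered text of `stub_layerSideTwoInv` (v7) is now a THEOREM -/

/-- If `p^L ∣ p^e · z` in `ℤ_[p]` with `e ≤ L`, then `p^(L-e) ∣ z`. [folklore] -/
theorem pow_sub_dvd_of_pow_dvd_pow_mul {p : ℕ} [hp : Fact p.Prime] {L e : ℕ} (he : e ≤ L) {z : ℤ_[p]}
    (h : (p : ℤ_[p]) ^ L ∣ (p : ℤ_[p]) ^ e * z) : (p : ℤ_[p]) ^ (L - e) ∣ z := by
  obtain ⟨d, rfl⟩ := Nat.exists_eq_add_of_le he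
  rw [Nat.add_sub_cancel_left, pow_add] at *
  have hp0 : (p : ℤ_[p]) ^ e ≠ 0 := pow_ne_zero _ (by exact_mod_cast hp.out.ne_zero)
  exact (mul_dvd_mul_iff_left hp0).mp h

/-- Level descent of a vanishing residue in `ℤ_[p]`: if `(c * p^e * y) mod p^L = 0` and `e + k ≤ L` then `(c * y) mod p^k = 0`
(`ker (mod p^n) = (p^n)`, cancellation of `p^e`). [folklore] -/
theorem toZModPow_mul_eq_zero_of_level {p : ℕ} [hp : Fact p.Prime] {L e k : ℕ} (hk : e + k ≤ L) (c y : ℤ_[p])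
    (h : PadicInt.toZModPow L (c * (p : ℤ_[p]) ^ e * y) = 0) : PadicInt.toZModPow k (c * y) = 0 := by
  have hker : c * (p : ℤ_[p]) ^ e * y ∈ RingHom.ker (PadicInt.toZModPow L) := h
  rw [PadicInt.ker_toZModPow, Ideal.mem_span_singleton] at hker
  have h1 : (p : ℤ_[p]) ^ (L - e) ∣ c * y := by
    refine pow_sub_dvd_of_pow_dvd_pow_mul (by omega) ?_
    rwa [← mul_assoc, mul_comm ((p : ℤ_[p]) ^ e) c]
  have h2 : (p : ℤ_[p]) ^ k ∣ c * y := (pow_dvd_pow _ (by omega)).trans h1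
  change c * y ∈ RingHom.ker (PadicInt.toZModPow k)
  rw [PadicInt.ker_toZModPow, Ideal.mem_span_singleton]
  exact h2

/-- (P1) iterated along the pin: `pair n (proj n x) P = pair (n + e) (proj (n + e) x) P` for `P ∈ E(ℚ_{n,v})`. [cite: Kobayashi2003, (8.23) (p. 18)] -/
theorem pair_proj_eq_pair_proj_add {v : HeightOneSpectrum (𝓞 ℚ)} {W : WeierstrassCurve ℚ} [W.IsElliptic]
    [ContinuousSMul ℤ_[2] (W.tateModule 2)] {κ : ZpExtension ℚ 2}
    {γ : absoluteGaloisGroup ℚ} (I : Kato2004.IwasawaH1Data W 2 κ γ)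
    (pair : ∀ n : ℕ, H1 (tateRep W 2) (κ.layerSubgroup n) →ₗ[ℤ_[2]]
      (localLayerPointsOfEmb κ (closureEmb (K := ℚ) (v.adicCompletion ℚ)) W n →+ ℤ_[2]))
    (hP1 : ∀ (n : ℕ) (x : H1 (tateRep W 2) (κ.layerSubgroup (n + 1))) (Q : localPoints W (v.adicCompletion ℚ))
      (hQ : Q ∈ localLayerPointsOfEmb κ (closureEmb (K := ℚ) (v.adicCompletion ℚ)) W n),
      pair n (layerCores (tateRep W 2) κ n x) ⟨Q, hQ⟩ =
        pair (n + 1) x ⟨Q, localLayerPointsOfEmb_mono κ (closureEmb (K := ℚ) (v.adicCompletion ℚ)) W (Nat.le_succ n) hQ⟩)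
    (x : I.H) (n e : ℕ) (P : localPoints W (v.adicCompletion ℚ))
    (hP : P ∈ localLayerPointsOfEmb κ (closureEmb (K := ℚ) (v.adicCompletion ℚ)) W n) :
    pair n (I.proj n x) ⟨P, hP⟩ =
      pair (n + e) (I.proj (n + e) x) ⟨P, localLayerPointsOfEmb_mono κ _ W (Nat.le_add_right n e) hP⟩ := by
  induction e with
  | zero => rfl
  | succ e ih =>
    rw [ih, ← I.cores_proj (n + e) x]
    exact hP1 (n + e) (I.proj (n + e + 1) x) P _

/-- **(R2c) from S2 ∧ S3′** — the v7 registered research stub, now DERIVED (kernel glue): data from S3′; `m := 1`; (PT-orth) at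
`(n, x, t, φ, Q, k)`: descend the Kummer witness to a layer `N ≥ n` (`LayerWitness.exists_signedSelmerLayer_kummerWitness_two`,
GoodSS at `2`), apply S2 at level `L₀ = k + K₀ + j` (`2^{K₀} φ_N = 0`, `2^j R = 0`), read through (P3), descend the level
(`toZModPow_mul_eq_zero_of_level`), and move back to layer `n` by (P1) along the pin. [cite: Kobayashi2003, (7.16)–(7.21), (8.23)]
[cite: Kato2004Asterisque, §17.13 (p. 279)] -/
theorem stub_layerSideTwoInv :
    ∀ (v : HeightOneSpectrum (𝓞 ℚ)), ((2 : ℕ) : 𝓞 ℚ) ∈ v.asIdeal →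
    ∀ (W : WeierstrassCurve ℚ) [W.IsElliptic] [W.IsGloballyMinimal],
      ¬ W.HasCM → W.analyticRank = 0 → GoodSS W 2 → W.frobeniusTrace 2 = 0 →
      ∀ (κ : ZpExtension ℚ 2) (γ : Field.absoluteGaloisGroup ℚ) (hκ : κ.IsCyclotomic),
        κ.IsTopGenerator γ → IsCyclotomicVariable 2 γ →
        ∀ [NeZero (W.conductorNorm ℤ)] (f : CuspForm (Gamma0 (W.conductorNorm ℤ)) 2),
          IsNewformOf W f → ∀ (ϖ : ℚ), (ϖ : ℝ) * W.realPeriodRat = plusPeriod f →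
        ∀ (Lplus Lminus : IwasawaAlgebra 2), IsPollackPair f 2 Lplus Lminus →
        ∀ [ContinuousSMul ℤ_[2] (W.tateModule 2)] [Module.Free ℤ_[2] (W.tateModule 2)]
          [Module.Finite ℤ_[2] (W.tateModule 2)],
        ∀ 𝔭 : PrimeSpectrum (IwasawaAlgebra 2), 𝔭.asIdeal.height = 1 →
          PowerSeries.C (2 : ℤ_[2]) ∉ 𝔭.asIdeal →
        ∃ (g : absoluteGaloisGroup (v.adicCompletion ℚ))
          (_ : κ.IsTopGenerator (resGalOfEmb (closureEmb (K := ℚ) (v.adicCompletion ℚ)) g))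
          (d : ℕ → localPoints W (v.adicCompletion ℚ))
          (I : Kato2004.IwasawaH1Data W 2 κ γ)
          (pair : ∀ n : ℕ, H1 (tateRep W 2) (κ.layerSubgroup n) →ₗ[ℤ_[2]]
            (localLayerPointsOfEmb κ (closureEmb (K := ℚ) (v.adicCompletion ℚ)) W n →+ ℤ_[2]))
          (s : I.H) (m : ℕ),
          (∀ n, d n ∈ localLayerPointsOfEmb κ (closureEmb (K := ℚ) (v.adicCompletion ℚ)) W n) ∧
          (∀ n, localTraceOfEmb κ (closureEmb (K := ℚ) (v.adicCompletion ℚ)) W (n + 1) (n + 2) (d (n + 2)) = -d n) ∧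
          (∀ n : ℕ, 1 ≤ n → ∀ P ∈ localLayerPointsOfEmb κ (closureEmb (K := ℚ) (v.adicCompletion ℚ)) W n,
            ∃ B ∈ AddSubgroup.closure (Set.range fun σ : absoluteGaloisGroup (v.adicCompletion ℚ) ↦ σ • d n),
              ∃ P' ∈ localLayerPointsOfEmb κ (closureEmb (K := ℚ) (v.adicCompletion ℚ)) W (n - 1),
              ∃ R ∈ localLayerPointsOfEmb κ (closureEmb (K := ℚ) (v.adicCompletion ℚ)) W n, P = B + P' + 2 • R) ∧
          (∀ P ∈ localLayerPointsOfEmb κ (closureEmb (K := ℚ) (v.adicCompletion ℚ)) W 0,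
            ∃ a : ℤ, ∃ R ∈ localLayerPointsOfEmb κ (closureEmb (K := ℚ) (v.adicCompletion ℚ)) W 0, P = a • d 0 + 2 • R) ∧
          (∀ (n : ℕ) (x : H1 (tateRep W 2) (κ.layerSubgroup (n + 1))) (Q : localPoints W (v.adicCompletion ℚ))
            (hQ : Q ∈ localLayerPointsOfEmb κ (closureEmb (K := ℚ) (v.adicCompletion ℚ)) W n),
            pair n (layerCores (tateRep W 2) κ n x) ⟨Q, hQ⟩ =
              pair (n + 1) x ⟨Q, localLayerPointsOfEmb_mono κ (closureEmb (K := ℚ) (v.adicCompletion ℚ)) W (Nat.le_succ n) hQ⟩) ∧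
          (∀ (n : ℕ) (y : H1 (tateRep W 2) (κ.layerSubgroup n)) (Q : localPoints W (v.adicCompletion ℚ))
            (hQ : Q ∈ localLayerPointsOfEmb κ (closureEmb (K := ℚ) (v.adicCompletion ℚ)) W n),
            pair n (conjMap (tateRep W 2).toTopRep (κ.layerSubgroup n) (resGalOfEmb (closureEmb (K := ℚ) (v.adicCompletion ℚ)) g) 1 y)
              ⟨g • Q, smul_mem_localLayerPointsOfEmb κ (closureEmb (K := ℚ) (v.adicCompletion ℚ)) W n g hQ⟩ = pair n y ⟨Q, hQ⟩) ∧
          (∀ (n : ℕ) (x : I.H) (t : W.subgroupH1 2 κ.kerSubgroup), t ∈ signedSelmerInfty W κ 1 →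
            ∀ (φ : contOneCocycles (discreteTopRep κ.kerSubgroup (W.geomPrimaryTorsion 2)))
              (Q : localPoints W (v.adicCompletion ℚ)) (k : ℕ), oneCocycleClass _ φ = t →
            ∀ hQn : 2 ^ k • Q ∈ localLayerPointsOfEmb κ (closureEmb (K := ℚ) (v.adicCompletion ℚ)) W n,
            2 ^ k • Q ∈ (⨆ n, signedLocalPoints κ (v.adicCompletion ℚ) W 1 n) →
            (∀ τ : localSubgroupOfEmb κ.kerSubgroup (closureEmb (K := ℚ) (v.adicCompletion ℚ)),
              pointsMapOfEmb W (closureEmb (K := ℚ) (v.adicCompletion ℚ))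
                  ((φ.1 (resGalSubgroupOfEmb κ.kerSubgroup _ τ) : W.geomPrimaryTorsion 2) : W.geomPoints) =
                (τ : absoluteGaloisGroup (v.adicCompletion ℚ)) • Q - Q) →
            (PadicInt.toZModPow k (2 ^ m * pair n (I.proj n x) ⟨2 ^ k • Q, hQn⟩)).val •
              ((((2 : ℚ) ^ k)⁻¹ : ℚ) : AddCircle (1 : ℚ)) = 0) ∧
          Kato2004.IsEulerSystemClassTwo W hκ I s ∧
          (∀ col₀ : I.H →+ (localTowerPointsOfEmb κ (closureEmb (K := ℚ) (v.adicCompletion ℚ)) W →+ ℤ_[2]),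
            (∀ (n : ℕ) (x : I.H) (Q : localPoints W (v.adicCompletion ℚ)) (hQ : Q ∈ localLayerPointsOfEmb κ (closureEmb (K := ℚ) (v.adicCompletion ℚ)) W n),
              col₀ x ⟨Q, localLayerPointsOfEmb_le_localTowerPointsOfEmb κ (closureEmb (K := ℚ) (v.adicCompletion ℚ)) W n hQ⟩ = pair n (I.proj n x) ⟨Q, hQ⟩) →
            ∀ Ls Lf : IwasawaAlgebra 2, IsColemanPair κ (closureEmb (K := ℚ) (v.adicCompletion ℚ)) W 0 g d (col₀ s) Ls Lf →
              lengthAt (IwasawaAlgebra 2) (IwasawaAlgebra 2 ⧸ Ideal.span {Lf}) 𝔭 ≤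
                lengthAt (IwasawaAlgebra 2) (IwasawaAlgebra 2 ⧸ Ideal.span {kobayashiL 1 Lplus Lminus}) 𝔭) := by
  intro v hv W _ _ hcm hr hss ha κ γ hκ hγ hvar _ f hf ϖ hϖ Lplus Lminus hPol _ _ _ 𝔭 h𝔭 h2
  obtain ⟨g, hg, d, I, pair, s, ePk, hμ, hadd₁, hadd₂, hgal, hL, hTR, hGEN, hGEN0, hP1, hP2, hW, hP3, hES, hERL⟩ :=
    stub_layerSideNoPTTwo v hv W hcm hr hss ha κ γ hκ hγ hvar f hf ϖ hϖ Lplus Lminus hPol 𝔭 h𝔭 h2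
  refine ⟨g, hg, d, I, pair, s, 1, hL, hTR, hGEN, hGEN0, hP1, hP2, ?_, hES, hERL⟩
  intro n x t ht φ Q k hφ hQn _ hw
  -- (1) descend the Kummer witness to a layer `N ≥ n`
  have hv' : (2 : 𝓞 ℚ) ∈ v.asIdeal := by exact_mod_cast hv
  obtain ⟨N, hnN, tN, htN, htNt, hall⟩ :=
    LayerWitness.exists_signedSelmerLayer_kummerWitness_two W hss κ 1 hv' ht φ hφ Q n k hQn hw
  obtain ⟨φN, hφN⟩ := oneCocycleClass_surjective _ tN
  obtain ⟨⟨K₀, hK₀⟩, R, hR⟩ := hall φN hφN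
  obtain ⟨jR, hjR⟩ := (AddCommGroup.mem_primaryComponent).1 R.2
  -- (2) the level `L₀` and the point `Q' = Q − ιR` with `2^{L₀} Q' = 2^{L₀-k} (2^k Q)`
  set L₀ : ℕ := k + K₀ + jR with hL₀
  set R' : localPoints W (v.adicCompletion ℚ) := pointsMapOfEmb W (closureEmb (K := ℚ) (v.adicCompletion ℚ)) (R : W.geomPoints)
    with hR'
  have hkill : ∀ y, (2 ^ L₀ : ℕ) • ((φN.1 y : W.geomPrimaryTorsion 2) : W.geomPoints) = 0 := fun y ↦ by
    rw [hL₀, show k + K₀ + jR = K₀ + (k + jR) from by omega, pow_add, mul_nsmul, hK₀, nsmul_zero]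
  have hR0 : (2 ^ L₀ : ℕ) • R' = 0 := by
    rw [hR', ← map_nsmul, hL₀, pow_add, mul_comm, mul_nsmul, hjR, nsmul_zero, map_zero]
  have hP'eq : (2 ^ L₀ : ℕ) • (Q - R') = (2 ^ (K₀ + jR) : ℕ) • ((2 ^ k : ℕ) • Q) := by
    rw [nsmul_sub, hR0, sub_zero, ← mul_nsmul, ← pow_add, hL₀, add_assoc]
  have hPN : (2 ^ k : ℕ) • Q ∈ localLayerPointsOfEmb κ (closureEmb (K := ℚ) (v.adicCompletion ℚ)) W N :=
    localLayerPointsOfEmb_mono κ _ W hnN hQn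
  have hP'mem : (2 ^ L₀ : ℕ) • (Q - R') ∈ localLayerPointsOfEmb κ (closureEmb (K := ℚ) (v.adicCompletion ℚ)) W N := by
    rw [hP'eq]; exact AddSubgroup.nsmul_mem _ hPN _
  -- (3) S2 at `(N, L₀)`
  have hS2 := stub_ptOrthLayerTwo v hv W κ hκ ePk hμ hadd₁ hadd₂ hgal hW N L₀ (I.proj N x) tN
    (signedSelmerLayer_le_selmerLayer W κ 1 N htN) φN hφN hkill (Q - R') hP'mem hR
  -- (4) through (P3): `2 • (pair N (proj N x) P' mod 2^{L₀}) = 0`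
  rw [← hP3] at hS2
  have hsub : (⟨(2 ^ L₀ : ℕ) • (Q - R'), hP'mem⟩ :
      localLayerPointsOfEmb κ (closureEmb (K := ℚ) (v.adicCompletion ℚ)) W N) = (2 ^ (K₀ + jR) : ℕ) • ⟨(2 ^ k : ℕ) • Q, hPN⟩ :=
    Subtype.ext hP'eq
  rw [hsub, map_nsmul, two_nsmul, ← two_mul, nsmul_eq_mul] at hS2
  have hS2' : PadicInt.toZModPow L₀ (2 * ((2 : ℕ) : ℤ_[2]) ^ (K₀ + jR) * pair N (I.proj N x) ⟨(2 ^ k : ℕ) • Q, hPN⟩) = 0 := by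
    rw [← Nat.cast_pow, mul_assoc, map_mul, map_ofNat]; exact hS2
  -- (5) level descent `L₀ → k` and (P1) along the pin back to layer `n`
  have hk : PadicInt.toZModPow k (2 * pair N (I.proj N x) ⟨(2 ^ k : ℕ) • Q, hPN⟩) = 0 :=
    toZModPow_mul_eq_zero_of_level (p := 2) (L := L₀) (e := K₀ + jR) (by rw [hL₀]; omega) 2 _ hS2'
  obtain ⟨e, rfl⟩ := Nat.exists_eq_add_of_le hnN
  rw [← pair_proj_eq_pair_proj_add I pair hP1 x n e _ hQn] at hk
  rw [pow_one, hk, ZMod.val_zero, zero_smul]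


/-- COMPOSITION (kernel-checked, no sorry of its own): K3P′ BY NAME = the landed LAYER-currency certificate
`SignedKatoOffTwo.signedKatoDivisibilityUpToAtTwo_of_contraFact_of_gzk_of_layerSide` (p603443) fed with the two PUB antecedents of K3P′ and
the DERIVED (R2c). -/
theorem SignedKatoDivisibilityUpToAtTwoOfPub_of :
    Summit.BirchSwinnertonDyer.BirchSwinnertonDyer.Theses.ThetaPartnerAtTwo.SignedKatoDivisibilityUpToAtTwoOfPub :=
  fun hK2 hGZK => signedKatoDivisibilityUpToAtTwo_of_contraFact_of_gzk_of_layerSide hK2 hGZK stub_layerSideTwoInv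

/-- The same composition read on the SECOND route wanting the item (`route-BirchSwinnertonDyer-ResidualThetaTransportAtTwo`, support r9). -/
theorem SignedKatoDivisibilityUpToAtTwoOfPub_proof :
    Summit.BirchSwinnertonDyer.BirchSwinnertonDyer.Theses.ResidualThetaTransportAtTwo.SignedKatoDivisibilityUpToAtTwoOfPub :=
  SignedKatoDivisibilityUpToAtTwoOfPub_of

end Summit.BirchSwinnertonDyer.BirchSwinnertonDyer.Cruxes.SignedKatoDivisibilityUpToAtTwoOfPub.ColemanRat

end
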